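import Summits.NavierStokesRegularity.FluidComputer.PalasekTowerEpisodes

/-!
# Gluing of a coherent chain of stages into a realisation of the Palasek tower

Cell `ns-blowup`, seat `ns-blowup-ecbridge-1` (g2); companion of `PalasekTowerEpisodes.lean`
(p404510). LABEL: E-C typing (kernel bookkeeping); WHAT THIS IS NOT: not Navier–Stokes evidence —
nothing is constructed; a GIVEN coherent chain of slab solutions is glued.

`Realisation.ofEpisodes` (p404510) glues the chain it CHOOSES (by the induction step, `Classical.choose`
along `ℕ`). The re-typed splits after the K-probe (STATUS l.911) need the same gluing for a chain that
is GIVEN — by compactness (`TowerCompactness`, file `PalasekTowerDepth.lean`) or by heredity inside a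
design class — so this file proves it once, for any schedule and any margin:
`Assembly.agree_of_extends` (pairwise `Extends` ⇒ agreement of any later link with any earlier one on
the earlier slab), `Realisation.ofChain` (the glued classical solution on `[0, T)` with datum, force,
energy, clock, floors, ceilings read off), `nonempty_realisation_of_chain`.

References: S. Palasek, arXiv:2605.13827 §4 [cite: Palasek2026ElementaryModel, §4];
J. T. Beale, T. Kato, A. Majda, Comm. Math. Phys. 94 (1984) §1 [cite: BealeKatoMajda1984, §1].
-/

noncomputable section

namespace Summit.NavierStokesRegularity.FluidComputer.PalasekTowerClayBridge

open Set MeasureTheory Filter Topology Function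
open scoped ENNReal ContDiff NNReal
open Literature.Analysis.FluidPDE


namespace Assembly

variable {ν : ℝ} {R : TowerRates} {S : Schedule R} {m : Margins R}

/-- In a coherent chain any later link agrees with an earlier one on the earlier slab. [folklore] -/
theorem agree_of_extends (s : (n : ℕ) → Stage ν R S m (n + 1))
    (hs : ∀ n, (s n).Extends (s (n + 1))) {i j : ℕ} (hij : i ≤ j) :
    ∀ t ∈ Icc 0 (S.τ (i + 1)), (s j).u t = (s i).u t ∧ (s j).p t = (s i).p t := by
  induction j, hij using Nat.le_induction with
  | base => intro t _; exact ⟨rfl, rfl⟩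
  | succ j hle ih =>
    intro t ht
    have ht' : t ∈ Icc 0 (S.τ (j + 1)) :=
      ⟨ht.1, le_trans ht.2 (S.τ_mono (Nat.succ_le_succ hle))⟩
    obtain ⟨hu, hp⟩ := hs j t ht'
    obtain ⟨hu', hp'⟩ := ih t ht
    exact ⟨hu.trans hu', hp.trans hp'⟩

end Assembly

open Assembly in
/-- **Gluing of a coherent chain.** From stages at every level of one schedule, each extending the
previous one, a realisation of the tower at the same viscosity: glue the increasing chain of slab
solutions into one classical solution on `[0, T)` (joint smoothness and the one-sided time
derivative are local, and every point of `[0, T) × ℝ³` lies in the relative interior of some slab,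
where the glued field IS a link of the chain) and read off datum, force, energy, clock, floors and
ceilings. (The proof of `Realisation.ofEpisodes`, with the chain given rather than chosen.)
[folklore] -/
def Realisation.ofChain {ν : ℝ} {R : TowerRates} {m : Margins R} (S : Schedule R)
    (st : (n : ℕ) → Stage ν R S m (n + 1)) (hst : ∀ n, (st n).Extends (st (n + 1))) :
    Realisation ν R := by
  classical
  -- the index of the first slab containing `t`
  let idx : ℝ → ℕ := fun t => if h : ∃ n, t ≤ S.τ (n + 1) then Nat.find h else 0
  let U : ℝ → EuclideanSpace ℝ (Fin 3) → EuclideanSpace ℝ (Fin 3) := fun t => (st (idx t)).u t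
  let P : ℝ → EuclideanSpace ℝ (Fin 3) → ℝ := fun t => (st (idx t)).p t
  -- on the slab `[0, τ (n+1)]` the glued fields are the `n`-th link
  have hUP : ∀ n, ∀ t ∈ Icc 0 (S.τ (n + 1)), U t = (st n).u t ∧ P t = (st n).p t := by
    intro n t ht
    have hex : ∃ i, t ≤ S.τ (i + 1) := ⟨n, ht.2⟩
    have hidx : idx t = Nat.find hex := by
      simp only [idx]
      rw [dif_pos hex]
    have hle : Nat.find hex ≤ n := Nat.find_min' hex ht.2
    have hti : t ∈ Icc 0 (S.τ (Nat.find hex + 1)) := ⟨ht.1, Nat.find_spec hex⟩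
    obtain ⟨hu, hp⟩ := agree_of_extends st hst hle t hti
    refine ⟨?_, ?_⟩
    · show (st (idx t)).u t = (st n).u t
      rw [hidx]; exact hu.symm
    · show (st (idx t)).p t = (st n).p t
      rw [hidx]; exact hp.symm
  have hU : ∀ n, ∀ t ∈ Icc 0 (S.τ (n + 1)), U t = (st n).u t := fun n t ht => (hUP n t ht).1
  have hP : ∀ n, ∀ t ∈ Icc 0 (S.τ (n + 1)), P t = (st n).p t := fun n t ht => (hUP n t ht).2
  -- every `t < T` lies strictly inside some slab
  have hslab : ∀ t, t < S.T → ∃ n, t < S.τ (n + 1) := fun t ht => S.exists_lt_τ ht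
  -- relative openness: the slab is a neighbourhood within the half-open strip
  have hnhds : ∀ {n : ℕ} {z : ℝ × EuclideanSpace ℝ (Fin 3)}, z.1 < S.τ (n + 1) →
      z ∈ Ico (0 : ℝ) S.T ×ˢ (univ : Set (EuclideanSpace ℝ (Fin 3))) →
      Icc (0 : ℝ) (S.τ (n + 1)) ×ˢ (univ : Set (EuclideanSpace ℝ (Fin 3))) ∈
        𝓝[Ico (0 : ℝ) S.T ×ˢ univ] z := by
    intro n z hz hzm
    refine mem_nhdsWithin.2 ⟨{w | w.1 < S.τ (n + 1)}, isOpen_lt continuous_fst continuous_const,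
      hz, ?_⟩
    rintro w ⟨hw1, hw2⟩
    exact mk_mem_prod ⟨hw2.1.1, le_of_lt hw1⟩ (mem_univ _)
  -- local agreement of the glued fields with a link, as eventual equalities
  have hUev : ∀ {n : ℕ} {z : ℝ × EuclideanSpace ℝ (Fin 3)}, z.1 < S.τ (n + 1) →
      z ∈ Ico (0 : ℝ) S.T ×ˢ (univ : Set (EuclideanSpace ℝ (Fin 3))) →
      uncurry U =ᶠ[𝓝[Ico (0 : ℝ) S.T ×ˢ univ] z] uncurry (st n).u := by
    intro n z hz hzm
    filter_upwards [hnhds hz hzm] with w hw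
    simp only [uncurry]
    rw [hU n w.1 hw.1]
  have hPev : ∀ {n : ℕ} {z : ℝ × EuclideanSpace ℝ (Fin 3)}, z.1 < S.τ (n + 1) →
      z ∈ Ico (0 : ℝ) S.T ×ˢ (univ : Set (EuclideanSpace ℝ (Fin 3))) →
      uncurry P =ᶠ[𝓝[Ico (0 : ℝ) S.T ×ˢ univ] z] uncurry (st n).p := by
    intro n z hz hzm
    filter_upwards [hnhds hz hzm] with w hw
    simp only [uncurry]
    rw [hP n w.1 hw.1]
  -- joint smoothness of the glued fields on the half-open strip
  have hUsmooth : IsSmoothSpaceTimeOn (Ico 0 S.T) U := by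
    intro z hz
    obtain ⟨n, hn⟩ := hslab z.1 hz.1.2
    have hzn : z ∈ Icc (0 : ℝ) (S.τ (n + 1)) ×ˢ (univ : Set (EuclideanSpace ℝ (Fin 3))) :=
      mk_mem_prod ⟨hz.1.1, hn.le⟩ (mem_univ _)
    have h1 : ContDiffWithinAt ℝ ∞ (uncurry (st n).u) (Ico (0 : ℝ) S.T ×ˢ univ) z :=
      ((st n).classical.smooth_velocity z hzn).mono_of_mem_nhdsWithin (hnhds hn hz)
    refine h1.congr_of_eventuallyEq (hUev hn hz) ?_
    simp only [uncurry]
    rw [hU n z.1 ⟨hz.1.1, hn.le⟩]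
  have hPsmooth : IsSmoothSpaceTimeOn (Ico 0 S.T) P := by
    intro z hz
    obtain ⟨n, hn⟩ := hslab z.1 hz.1.2
    have hzn : z ∈ Icc (0 : ℝ) (S.τ (n + 1)) ×ˢ (univ : Set (EuclideanSpace ℝ (Fin 3))) :=
      mk_mem_prod ⟨hz.1.1, hn.le⟩ (mem_univ _)
    have h1 : ContDiffWithinAt ℝ ∞ (uncurry (st n).p) (Ico (0 : ℝ) S.T ×ˢ univ) z :=
      ((st n).classical.smooth_pressure z hzn).mono_of_mem_nhdsWithin (hnhds hn hz)
    refine h1.congr_of_eventuallyEq (hPev hn hz) ?_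
    simp only [uncurry]
    rw [hP n z.1 ⟨hz.1.1, hn.le⟩]
  -- the one-sided time derivative of the glued velocity is that of the link
  have hderiv : ∀ {n : ℕ} {t : ℝ}, t ∈ Ico (0 : ℝ) S.T → t < S.τ (n + 1) → ∀ x,
      timeDerivWithin (Ico 0 S.T) U t x = timeDerivWithin (Icc 0 (S.τ (n + 1))) (st n).u t x := by
    intro n t ht hn x
    have hτT : S.τ (n + 1) < S.T := S.τ_lt_T _
    have hset : Ico (0 : ℝ) S.T ∩ Iio (S.τ (n + 1)) = Ico 0 (S.τ (n + 1)) := by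
      ext s
      constructor
      · rintro ⟨⟨h0, _⟩, h2⟩; exact ⟨h0, h2⟩
      · rintro ⟨h0, h1⟩; exact ⟨⟨h0, lt_trans h1 hτT⟩, h1⟩
    calc timeDerivWithin (Ico 0 S.T) U t x
        = derivWithin (fun s => U s x) (Ico 0 S.T ∩ Iio (S.τ (n + 1))) t := by
          rw [timeDerivWithin_apply, derivWithin_inter (Iio_mem_nhds hn)]
      _ = derivWithin (fun s => U s x) (Ico 0 (S.τ (n + 1))) t := by rw [hset]
      _ = derivWithin (fun s => (st n).u s x) (Ico 0 (S.τ (n + 1))) t := by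
          apply derivWithin_congr
          · intro s hs
            show U s x = (st n).u s x
            rw [hU n s ⟨hs.1, hs.2.le⟩]
          · show U t x = (st n).u t x
            rw [hU n t ⟨ht.1, hn.le⟩]
      _ = timeDerivWithin (Ico 0 (S.τ (n + 1))) (st n).u t x := by rw [timeDerivWithin_apply]
      _ = timeDerivWithin (Icc 0 (S.τ (n + 1))) (st n).u t x :=
          (st n).classical.smooth_velocity.timeDerivWithin_eq_of_subset Ico_subset_Icc_self
            (uniqueDiffOn_Ico 0 (S.τ (n + 1))) ⟨ht.1, hn⟩ x
  -- the glued classical solution on `[0, T)`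
  have hclassical : IsClassicalNSSolutionOn (Ico 0 S.T) ν S.f U P := by
    refine ⟨hUsmooth, hPsmooth, ?_, ?_⟩
    · intro t ht x
      obtain ⟨n, hn⟩ := hslab t ht.2
      have hmom := (st n).classical.momentum t ⟨ht.1, hn.le⟩ x
      have hUt : U t = (st n).u t := hU n t ⟨ht.1, hn.le⟩
      have hPt : P t = (st n).p t := hP n t ⟨ht.1, hn.le⟩
      rw [hderiv ht hn x, hUt, hPt]
      exact hmom
    · intro t ht
      obtain ⟨n, hn⟩ := hslab t ht.2
      rw [hU n t ⟨ht.1, hn.le⟩]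
      exact (st n).classical.divFree t ⟨ht.1, hn.le⟩
  have hU0 : U 0 = S.u₀ := by
    rw [hU 0 0 ⟨le_rfl, (S.τ_pos 1).le⟩]
    exact (st 0).initial
  exact
  { T := S.T
    T_pos := S.T_pos
    u := U
    p := P
    f := S.f
    classical := hclassical
    datum_decay := by rw [hU0]; exact S.datum_decay
    force_smooth := S.force_smooth
    force_decay := S.force_decay
    force_silent := S.force_silent
    energy := by
      intro T' hT'
      obtain ⟨n, hn⟩ := hslab T' hT'
      obtain ⟨C, hC, hb⟩ := (st n).energy
      refine ⟨C, hC, fun t ht => ?_⟩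
      rw [hU n t ⟨ht.1, le_trans ht.2 hn.le⟩]
      exact hb t ⟨ht.1, le_trans ht.2 hn.le⟩
    radius := S.radius
    τ := S.τ
    τ_mem := fun k => ⟨(S.τ_pos k).le, S.τ_lt_T k⟩
    c₁ := S.c₁
    c₂ := S.c₂
    c₃ := S.c₃
    c₁_pos := S.c₁_pos
    clock := S.clock
    floor := by
      intro k
      obtain ⟨x, hx, hfl⟩ := (st k).floor k (Nat.le_succ k)
      refine ⟨x, hx, ?_⟩
      rw [hU k (S.τ k) ⟨(S.τ_pos k).le, S.τ_mono (Nat.le_succ k)⟩]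
      exact hfl
    ceiling := by
      intro k t ht x
      rw [hU k t ⟨ht.1, le_trans ht.2 (S.τ_mono (Nat.le_succ k))⟩]
      exact (st k).ceiling k (Nat.le_succ k) t ht x }

/-- **A coherent chain of stages realises the interface** (at the same viscosity): some schedule
with stages at every level, each extending the previous one, gives `Realisation ν R` by
`Realisation.ofChain`. [cite: Palasek2026ElementaryModel, §4] -/
theorem nonempty_realisation_of_chain {ν : ℝ} {R : TowerRates} {m : Margins R}
    (h : ∃ S : Schedule R, ∃ s : (n : ℕ) → Stage ν R S m (n + 1), ∀ n, (s n).Extends (s (n + 1))) :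
    Nonempty (Realisation ν R) := by
  obtain ⟨S, s, hs⟩ := h
  exact ⟨Realisation.ofChain S s hs⟩

end Summit.NavierStokesRegularity.FluidComputer.PalasekTowerClayBridge

end
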